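import Summits.CriticalPhenomena.PercolationContinuityZ3.Theorems.PercNearOneGluingNoHeavyLowerTailIncStarTargetEdgeInduction
import Summits.CriticalPhenomena.PercolationContinuityZ3.Theorems.PercNearOneGluingNoHeavyLowerTailIncStarStrongInduction
import Summits.CriticalPhenomena.PercolationContinuityZ3.Theorems.PercNearOneGluingAdditiveGluingTieLiftOne
import HarnessLib

/-!
# Concavity, chord and Bernstein positivity of Sahi's cubic along one pair — and the increasing star

Support file for the Sahi programme (`--supports stmt-CriticalPhenomena-4575`, prover prim-sahi-p2 gen 16).  No definitions, no named
facts, no sorries; standard axioms.  Memo `run/shared/lean/prim/prim-sahi/FROM-prim-sahi-p2-gen16-*.md`, `prim-sahi-p2/PROOF-E3.md` §26.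

Along one pair `e`, with `μ = P_{w[e↦0]}`, `ν = P_{w[e↦1]}`, Sahi's cubic `f(p) = E₃(A,B,C)` under `prodBernoulli w[e↦p]` is the Bernstein cubic
with coefficients `B₀ = E₃(μ)`, `B₁ = polar₁ μ ν`, `B₂ = polar₁ ν μ`, `B₃ = E₃(ν)` (`EdgeInduction.sahiE3_oneBond`).  Writing
`δ_X = ν(X) − μ(X)` (for increasing events: the probability that `e` is pivotal for `X`), this file records the exact identities
* `B₃ − 3B₂ + 3B₁ − B₀ = δ_A δ_B δ_C`                                  (`polar₁_third_diff`; `= f'''/6`, nonnegative for up-sets),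
* `B₁ − 2B₂ + B₃ = ⅓(Σ_cyc ν(C) δ_A δ_B − Σ_cyc δ_A δ_{B∩C})`            (`polar₁_second_diff_one`; `= f''(1)/6`),
* `B₀ − 2B₁ + B₂ = ⅓(Σ_cyc μ(C) δ_A δ_B − Σ_cyc δ_A δ_{B∩C})`            (`polar₁_second_diff_zero`; `= f''(0)/6`),
* `3B₂ − B₀ − 2B₃ = Σ_cyc δ_A δ_{B∩C} − Σ_cyc μ(C) δ_A δ_B − 2 δ_Aδ_Bδ_C`  (`polar₁_chordSlack_one`; the chord slack at the `p = 1` end;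
  the slack at `p = 0` is `3B₁ − 2B₀ − B₃ =` the same `+ δ_Aδ_Bδ_C`, `polar₁_chordSlack_zero`),
valid for ARBITRARY measures and events (they are polynomial identities in the fourteen numbers `μ(·), ν(·)`).  Consequences (real arithmetic):
since `f''` is affine with `f''(1) − f''(0) = 6δ_Aδ_Bδ_C ≥ 0` for up-sets, `f` is concave on `[0,1]` iff `B₁ − 2B₂ + B₃ ≤ 0`
("pair-pivotality domination" `Σ_cyc δ_A δ_{B∩C} ≥ Σ_cyc ν(C) δ_A δ_B`); concavity ⟹ the chord property (`3B₁ ≥ 2B₀ + B₃`,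
`3B₂ ≥ B₀ + 2B₃`: `f` lies above the chord through its end values) ⟹ (given `B₀, B₃ ≥ 0`) Bernstein positivity `B₁, B₂ ≥ 0`
(`bernstein_nonneg_of_chord`, `chord_of_concave`).

For the INCREASING STAR `A,B,C = {s↔b},{s↔c},{s↔y}` the tree already reduces the whole inequality to Bernstein positivity along
TARGET–UNMARKED pairs `s(b,z)` (`IncStarIrreducible.incStar_nonneg_of_targetUnmarkedBernsteinStrongIH`).  Hence the corollary schemas
`incStar_nonneg_of_targetUnmarkedChord` and `incStar_nonneg_of_targetUnmarkedConcavity` / `…PairPivotality`: the star holds on every finite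
weighted graph as soon as, along every fractional target–unmarked pair, `E₃` lies above its chord — or is concave — given the star for all
weights with fewer fractional non-loop pairs.  STATUS of these hypotheses (census, not proved): the chord property and even `f''(0) ≤ 0` are FALSE
along ROOT pairs (bypass family `W2(k)`, n ≥ 8, and `RS-9`; run/shared/lean/ttrl/istar/ISTAR.md, C0.md — always through the degenerate far end
`B₃ = E₃(G/e) = 0`), whereas at NON-ROOT pairs no violation is known: ttrl's exhaustive census (all simple graphs n ≤ 7, weights in [1/20,19/20])
and 158 385 adversarially climbed end points (n = 8..12, target–Steiner controls included) contain chord failures at root pairs only, and on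
`K₅`/`K₆` the chord slacks are three-copy fibre-positive at target–target pairs (0 negative coefficients; target–Steiner: 0 on `K₅`, 7 263 of
2.7·10⁸ on `K₆`); prim-sahi-p2 gen 16 runs the concavity census (kit j184607).  Nothing in this file asserts these hypotheses.
-/

noncomputable section

namespace Summit.CriticalPhenomena.PercolationContinuityZ3.Theorems

namespace EdgeInduction

open MeasureTheory Literature.Probability.Percolation Literature.Probability.LatticeModels
open scoped Classical

variable {n : ℕ}

/-- **Third difference of the Bernstein coefficients** of `E₃` along a pair: `B₃ − 3B₂ + 3B₁ − B₀ = δ_A δ_B δ_C` with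
`δ_X = ν(X) − μ(X)` (one sixth of the third derivative of the cubic). [this work] -/
theorem polar₁_third_diff (μ ν : Measure (BondConfig (Fin n))) (A B C : Set (BondConfig (Fin n))) :
    sahiE3 ν A B C - 3 * polar₁ ν μ A B C + 3 * polar₁ μ ν A B C - sahiE3 μ A B C =
      (ν.real A - μ.real A) * (ν.real B - μ.real B) * (ν.real C - μ.real C) := by
  simp only [sahiE3, polar₁]
  ring

/-- **Second difference at the `p = 1` end**: `B₁ − 2B₂ + B₃ = ⅓(Σ_cyc ν(C)·δ_A δ_B − Σ_cyc δ_A·δ_{B∩C})` (one sixth of `f''(1)`). [this work] -/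
theorem polar₁_second_diff_one (μ ν : Measure (BondConfig (Fin n))) (A B C : Set (BondConfig (Fin n))) :
    polar₁ μ ν A B C - 2 * polar₁ ν μ A B C + sahiE3 ν A B C =
      (1 / 3 : ℝ) * ((ν.real C * (ν.real A - μ.real A) * (ν.real B - μ.real B)
          + ν.real A * (ν.real B - μ.real B) * (ν.real C - μ.real C)
          + ν.real B * (ν.real A - μ.real A) * (ν.real C - μ.real C))
        - ((ν.real A - μ.real A) * (ν.real (B ∩ C) - μ.real (B ∩ C))
          + (ν.real B - μ.real B) * (ν.real (A ∩ C) - μ.real (A ∩ C))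
          + (ν.real C - μ.real C) * (ν.real (A ∩ B) - μ.real (A ∩ B)))) := by
  simp only [sahiE3, polar₁]
  ring

/-- **Second difference at the `p = 0` end**: `B₀ − 2B₁ + B₂ = ⅓(Σ_cyc μ(C)·δ_A δ_B − Σ_cyc δ_A·δ_{B∩C})` (one sixth of `f''(0)`). [this work] -/
theorem polar₁_second_diff_zero (μ ν : Measure (BondConfig (Fin n))) (A B C : Set (BondConfig (Fin n))) :
    sahiE3 μ A B C - 2 * polar₁ μ ν A B C + polar₁ ν μ A B C =
      (1 / 3 : ℝ) * ((μ.real C * (ν.real A - μ.real A) * (ν.real B - μ.real B)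
          + μ.real A * (ν.real B - μ.real B) * (ν.real C - μ.real C)
          + μ.real B * (ν.real A - μ.real A) * (ν.real C - μ.real C))
        - ((ν.real A - μ.real A) * (ν.real (B ∩ C) - μ.real (B ∩ C))
          + (ν.real B - μ.real B) * (ν.real (A ∩ C) - μ.real (A ∩ C))
          + (ν.real C - μ.real C) * (ν.real (A ∩ B) - μ.real (A ∩ B)))) := by
  simp only [sahiE3, polar₁]
  ring

/-- **Chord slack at the `p = 1` end in pivotal form**: `3B₂ − B₀ − 2B₃ = Σ_cyc δ_A δ_{B∩C} − Σ_cyc μ(C) δ_A δ_B − 2δ_Aδ_Bδ_C`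
(the quantity `R2` of the chord census; the cubic lies above its chord on `[0,1]` iff this and `polar₁_chordSlack_zero` are `≥ 0`). [this work] -/
theorem polar₁_chordSlack_one (μ ν : Measure (BondConfig (Fin n))) (A B C : Set (BondConfig (Fin n))) :
    3 * polar₁ ν μ A B C - sahiE3 μ A B C - 2 * sahiE3 ν A B C =
      ((ν.real A - μ.real A) * (ν.real (B ∩ C) - μ.real (B ∩ C))
          + (ν.real B - μ.real B) * (ν.real (A ∩ C) - μ.real (A ∩ C))
          + (ν.real C - μ.real C) * (ν.real (A ∩ B) - μ.real (A ∩ B)))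
        - (μ.real C * (ν.real A - μ.real A) * (ν.real B - μ.real B)
          + μ.real A * (ν.real B - μ.real B) * (ν.real C - μ.real C)
          + μ.real B * (ν.real A - μ.real A) * (ν.real C - μ.real C))
        - 2 * ((ν.real A - μ.real A) * (ν.real B - μ.real B) * (ν.real C - μ.real C)) := by
  simp only [sahiE3, polar₁]
  ring

/-- **Chord slack at the `p = 0` end**: `3B₁ − 2B₀ − B₃ = (3B₂ − B₀ − 2B₃) + δ_Aδ_Bδ_C` (`R1 = R2 + π³`). [this work] -/
theorem polar₁_chordSlack_zero (μ ν : Measure (BondConfig (Fin n))) (A B C : Set (BondConfig (Fin n))) :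
    3 * polar₁ μ ν A B C - 2 * sahiE3 μ A B C - sahiE3 ν A B C =
      (3 * polar₁ ν μ A B C - sahiE3 μ A B C - 2 * sahiE3 ν A B C)
        + (ν.real A - μ.real A) * (ν.real B - μ.real B) * (ν.real C - μ.real C) := by
  simp only [sahiE3, polar₁]
  ring

/-- For up-sets, opening a pair raises probabilities, so the third difference `δ_Aδ_Bδ_C` is nonnegative: the second difference of the
Bernstein coefficients at the `p = 0` end is at most the one at the `p = 1` end (`f''` is nondecreasing). [this work] -/
theorem second_diff_zero_le_one (w : Sym2 (Fin n) → unitInterval) (e : Sym2 (Fin n)) {A B C : Set (BondConfig (Fin n))}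
    (hA : IsUpperSet A) (hB : IsUpperSet B) (hC : IsUpperSet C) :
    sahiE3 (prodBernoulli (Function.update w e 0)) A B C
        - 2 * polar₁ (prodBernoulli (Function.update w e 0)) (prodBernoulli (Function.update w e 1)) A B C
        + polar₁ (prodBernoulli (Function.update w e 1)) (prodBernoulli (Function.update w e 0)) A B C ≤
      polar₁ (prodBernoulli (Function.update w e 0)) (prodBernoulli (Function.update w e 1)) A B C
        - 2 * polar₁ (prodBernoulli (Function.update w e 1)) (prodBernoulli (Function.update w e 0)) A B C
        + sahiE3 (prodBernoulli (Function.update w e 1)) A B C := by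
  have h3 := polar₁_third_diff (prodBernoulli (Function.update w e 0)) (prodBernoulli (Function.update w e 1)) A B C
  have hδ : 0 ≤ ((prodBernoulli (Function.update w e 1)).real A - (prodBernoulli (Function.update w e 0)).real A)
      * ((prodBernoulli (Function.update w e 1)).real B - (prodBernoulli (Function.update w e 0)).real B)
      * ((prodBernoulli (Function.update w e 1)).real C - (prodBernoulli (Function.update w e 0)).real C) :=
    mul_nonneg (mul_nonneg (sub_nonneg.2 (tieLiftOne_real_zero_le_one w e hA))
      (sub_nonneg.2 (tieLiftOne_real_zero_le_one w e hB))) (sub_nonneg.2 (tieLiftOne_real_zero_le_one w e hC))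
  linarith

/-- **Concavity at the `p = 1` end ⟹ chord property**: if `B₁ − 2B₂ + B₃ ≤ 0` and the third difference is `≥ 0`, then
`3B₁ ≥ 2B₀ + B₃` and `3B₂ ≥ B₀ + 2B₃`. [this work] -/
theorem chord_of_concave {B₀ B₁ B₂ B₃ : ℝ} (hconc : B₁ - 2 * B₂ + B₃ ≤ 0) (hthird : 0 ≤ B₃ - 3 * B₂ + 3 * B₁ - B₀) :
    2 * B₀ + B₃ ≤ 3 * B₁ ∧ B₀ + 2 * B₃ ≤ 3 * B₂ := by
  constructor <;> linarith

/-- **Chord property ⟹ Bernstein positivity** (given nonnegative end values). [this work] -/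
theorem bernstein_nonneg_of_chord {B₀ B₁ B₂ B₃ : ℝ} (h0 : 0 ≤ B₀) (h3 : 0 ≤ B₃)
    (hc1 : 2 * B₀ + B₃ ≤ 3 * B₁) (hc2 : B₀ + 2 * B₃ ≤ 3 * B₂) : 0 ≤ B₁ ∧ 0 ≤ B₂ := by
  constructor <;> linarith

end EdgeInduction

namespace IncStarIrreducible

open MeasureTheory Literature.Probability.Percolation Literature.Probability.LatticeModels EdgeInduction
open scoped Classical

variable {n : ℕ}

/-- **TARGET–UNMARKED CHORD SCHEMA.**  If along every fractional target–unmarked pair `e = s(b,z)` (`z ∉ {s,b,c,y}`) Sahi's cubic of the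
increasing star lies above its chord — `3B₁ ≥ 2B₀ + B₃` and `3B₂ ≥ B₀ + 2B₃` for the Bernstein coefficients along `e` — whenever the star holds
for every weight with fewer fractional non-loop pairs and every marking, then `E₃({s↔b},{s↔c},{s↔y}) ≥ 0` on every finite weighted graph.
(Corollary of `incStar_nonneg_of_targetUnmarkedBernsteinStrongIH` and `bernstein_nonneg_of_chord`.) [this work] -/
theorem incStar_nonneg_of_targetUnmarkedChord
    (h : ∀ (w : Sym2 (Fin n) → unitInterval) (s b c y z : Fin n), z ≠ s → z ≠ b → z ≠ c → z ≠ y → s(b, z) ∈ fracEdges w →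
      (∀ w' : Sym2 (Fin n) → unitInterval,
          ((fracEdges w').filter fun e => ¬ e.IsDiag).card < ((fracEdges w).filter fun e => ¬ e.IsDiag).card →
          ∀ s' b' c' y' : Fin n, 0 ≤ sahiE3 (prodBernoulli w') (openConn s' b') (openConn s' c') (openConn s' y')) →
      2 * sahiE3 (prodBernoulli (Function.update w s(b, z) 0)) (openConn s b) (openConn s c) (openConn s y)
          + sahiE3 (prodBernoulli (Function.update w s(b, z) 1)) (openConn s b) (openConn s c) (openConn s y) ≤
        3 * polar₁ (prodBernoulli (Function.update w s(b, z) 0)) (prodBernoulli (Function.update w s(b, z) 1))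
          (openConn s b) (openConn s c) (openConn s y) ∧
      sahiE3 (prodBernoulli (Function.update w s(b, z) 0)) (openConn s b) (openConn s c) (openConn s y)
          + 2 * sahiE3 (prodBernoulli (Function.update w s(b, z) 1)) (openConn s b) (openConn s c) (openConn s y) ≤
        3 * polar₁ (prodBernoulli (Function.update w s(b, z) 1)) (prodBernoulli (Function.update w s(b, z) 0))
          (openConn s b) (openConn s c) (openConn s y)) :
    ∀ (w : Sym2 (Fin n) → unitInterval) (s b c y : Fin n),
      0 ≤ sahiE3 (prodBernoulli w) (openConn s b) (openConn s c) (openConn s y) := by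
  refine incStar_nonneg_of_targetUnmarkedBernsteinStrongIH fun w s b c y z hzs hzb hzc hzy he ih => ?_
  have hnd : ¬ (s(b, z)).IsDiag := by rw [Sym2.mk_isDiag_iff]; exact fun hh => hzb hh.symm
  have i0 := ih _ (IncStar.card_fracEdges_update_lt w he hnd 0 (Or.inl rfl)) s b c y
  have i1 := ih _ (IncStar.card_fracEdges_update_lt w he hnd 1 (Or.inr rfl)) s b c y
  obtain ⟨hc1, hc2⟩ := h w s b c y z hzs hzb hzc hzy he ih
  exact bernstein_nonneg_of_chord i0 i1 hc1 hc2

/-- **TARGET–UNMARKED CONCAVITY SCHEMA.**  If along every fractional target–unmarked pair `e = s(b,z)` Sahi's cubic of the increasing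
star is CONCAVE in the weight of `e` — equivalently (third difference `≥ 0`, `second_diff_zero_le_one`) its Bernstein coefficients satisfy
`B₁ − 2B₂ + B₃ ≤ 0` — whenever the star holds for every weight with fewer fractional non-loop pairs and every marking, then the increasing
star holds on every finite weighted graph. [this work] -/
theorem incStar_nonneg_of_targetUnmarkedConcavity
    (h : ∀ (w : Sym2 (Fin n) → unitInterval) (s b c y z : Fin n), z ≠ s → z ≠ b → z ≠ c → z ≠ y → s(b, z) ∈ fracEdges w →
      (∀ w' : Sym2 (Fin n) → unitInterval,
          ((fracEdges w').filter fun e => ¬ e.IsDiag).card < ((fracEdges w).filter fun e => ¬ e.IsDiag).card →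
          ∀ s' b' c' y' : Fin n, 0 ≤ sahiE3 (prodBernoulli w') (openConn s' b') (openConn s' c') (openConn s' y')) →
      polar₁ (prodBernoulli (Function.update w s(b, z) 0)) (prodBernoulli (Function.update w s(b, z) 1))
            (openConn s b) (openConn s c) (openConn s y)
          - 2 * polar₁ (prodBernoulli (Function.update w s(b, z) 1)) (prodBernoulli (Function.update w s(b, z) 0))
            (openConn s b) (openConn s c) (openConn s y)
          + sahiE3 (prodBernoulli (Function.update w s(b, z) 1)) (openConn s b) (openConn s c) (openConn s y) ≤ 0) :
    ∀ (w : Sym2 (Fin n) → unitInterval) (s b c y : Fin n),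
      0 ≤ sahiE3 (prodBernoulli w) (openConn s b) (openConn s c) (openConn s y) := by
  refine incStar_nonneg_of_targetUnmarkedChord fun w s b c y z hzs hzb hzc hzy he ih => ?_
  have hconc := h w s b c y z hzs hzb hzc hzy he ih
  have h3 := polar₁_third_diff (prodBernoulli (Function.update w s(b, z) 0)) (prodBernoulli (Function.update w s(b, z) 1))
    (openConn s b) (openConn s c) (openConn s y)
  have hδ : 0 ≤ ((prodBernoulli (Function.update w s(b, z) 1)).real (openConn s b)
        - (prodBernoulli (Function.update w s(b, z) 0)).real (openConn s b))
      * ((prodBernoulli (Function.update w s(b, z) 1)).real (openConn s c)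
        - (prodBernoulli (Function.update w s(b, z) 0)).real (openConn s c))
      * ((prodBernoulli (Function.update w s(b, z) 1)).real (openConn s y)
        - (prodBernoulli (Function.update w s(b, z) 0)).real (openConn s y)) :=
    mul_nonneg (mul_nonneg (sub_nonneg.2 (tieLiftOne_real_zero_le_one w _ (isUpperSet_openConn s b)))
      (sub_nonneg.2 (tieLiftOne_real_zero_le_one w _ (isUpperSet_openConn s c))))
      (sub_nonneg.2 (tieLiftOne_real_zero_le_one w _ (isUpperSet_openConn s y)))
  exact chord_of_concave hconc (by linarith)

/-- **PAIR-PIVOTALITY DOMINATION SCHEMA** (the concavity hypothesis in closed form).  Write `μ = P_{w[e↦0]}`, `ν = P_{w[e↦1]}` and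
`δ_X = ν(X) − μ(X)` (the probability that `e` is pivotal for `X`) for the three hub connections `X ∈ {s↔b, s↔c, s↔y}` and their pairwise
intersections.  If along every fractional target–unmarked pair `e = s(b,z)`
  `Σ_cyc δ_{s↔b} · δ_{{s↔c}∩{s↔y}}  ≥  Σ_cyc ν(s↔y) · δ_{s↔b} · δ_{s↔c}`
(pair-pivotality coincidences dominate single/single coincidences weighted by the far-end connection probability of the third target),
whenever the star holds for every weight with fewer fractional non-loop pairs and every marking, then the increasing star holds on every finite
weighted graph.  (`= incStar_nonneg_of_targetUnmarkedConcavity` via `polar₁_second_diff_one`.) [this work] -/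
theorem incStar_nonneg_of_targetUnmarkedPairPivotality
    (h : ∀ (w : Sym2 (Fin n) → unitInterval) (s b c y z : Fin n), z ≠ s → z ≠ b → z ≠ c → z ≠ y → s(b, z) ∈ fracEdges w →
      (∀ w' : Sym2 (Fin n) → unitInterval,
          ((fracEdges w').filter fun e => ¬ e.IsDiag).card < ((fracEdges w).filter fun e => ¬ e.IsDiag).card →
          ∀ s' b' c' y' : Fin n, 0 ≤ sahiE3 (prodBernoulli w') (openConn s' b') (openConn s' c') (openConn s' y')) →
      let μ := prodBernoulli (Function.update w s(b, z) 0)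
      let ν := prodBernoulli (Function.update w s(b, z) 1)
      ν.real (openConn s y) * (ν.real (openConn s b) - μ.real (openConn s b)) * (ν.real (openConn s c) - μ.real (openConn s c))
          + ν.real (openConn s b) * (ν.real (openConn s c) - μ.real (openConn s c)) * (ν.real (openConn s y) - μ.real (openConn s y))
          + ν.real (openConn s c) * (ν.real (openConn s b) - μ.real (openConn s b)) * (ν.real (openConn s y) - μ.real (openConn s y)) ≤
        (ν.real (openConn s b) - μ.real (openConn s b)) * (ν.real (openConn s c ∩ openConn s y) - μ.real (openConn s c ∩ openConn s y))
          + (ν.real (openConn s c) - μ.real (openConn s c)) * (ν.real (openConn s b ∩ openConn s y) - μ.real (openConn s b ∩ openConn s y))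
          + (ν.real (openConn s y) - μ.real (openConn s y)) * (ν.real (openConn s b ∩ openConn s c) - μ.real (openConn s b ∩ openConn s c))) :
    ∀ (w : Sym2 (Fin n) → unitInterval) (s b c y : Fin n),
      0 ≤ sahiE3 (prodBernoulli w) (openConn s b) (openConn s c) (openConn s y) := by
  refine incStar_nonneg_of_targetUnmarkedConcavity fun w s b c y z hzs hzb hzc hzy he ih => ?_
  have hpiv := h w s b c y z hzs hzb hzc hzy he ih
  have h2 := polar₁_second_diff_one (prodBernoulli (Function.update w s(b, z) 0)) (prodBernoulli (Function.update w s(b, z) 1))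
    (openConn s b) (openConn s c) (openConn s y)
  simp only at hpiv
  rw [h2]
  linarith

end IncStarIrreducible

/-! ## Addendum (same gen, later in the session): pivotal forms of the mixed coefficients, and the STATUS of the schemas' hypotheses

EXACT REFUTATIONS (prim-sahi-p2 gen 16, exact rational arithmetic, two code paths; memo FROM-prim-sahi-p2-gen16-*.md, `prim-sahi-p2/gen16/py/w2k_tz.py`,
`w23_zz.py`).  The chord and concavity hypotheses of `incStar_nonneg_of_targetUnmarkedChord` / `…Concavity` / `…PairPivotality` are NOT universally
true: in the bypass family `W2(k)` (root `0`, hub `h` joined to the root by the pair `s(0,h)` and by `k` two-edge bypasses `0 – vⱼ – h` of weight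
`19/20` each, targets hanging on the hub, one of them also tied to the root through a Steiner vertex) the MIRROR pairs `s(h, vⱼ)` fail exactly
like the root pairs `s(0, vⱼ)` do: with the hub a TARGET (`W2(3)`, weights `(h,t₂)=1/10, (h,4)=(h,t₃)=3/4, (t₃,4)=(0,4)=1/4, (h,5)=3/4`,
`(0,h)=9/10`) the target–unmarked pair `s(h,v₁)` has `3B₂ − B₀ − 2B₃ = −6.25·10⁻¹²` (chord fails at the `p = 1` end) and already at
`(0,h) = 1/2` it has `2B₂ − B₁ − B₃ = −1.44·10⁻¹⁰` (concavity fails, chord still holds); in `W2(4)` both chord slacks are negative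
(`−2.2·10⁻¹², −5.7·10⁻¹²`); with the hub UNMARKED the same numbers refute chord/concavity at the unmarked–unmarked pairs `s(h,vⱼ)`.  In all
these witnesses `B₁, B₂ > 0` comfortably: along target–unmarked pairs ONLY Bernstein positivity (the hypothesis of
`incStar_nonneg_of_targetUnmarkedBernsteinStrongIH`) survives, exactly as along root pairs (ttrl ISTAR.md).  Target–target pairs: chord
slacks fibre-positive on `K₅`, `K₆` (ttrl), concavity slack fibre-positive on `K₅` (this gen) — unrefuted, but the target–target step is
already a theorem (`IncStar.targetTarget_polar_nonneg`).  The three schemas above therefore stand as conditional skeletons whose hypotheses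
fail on some weighted graphs (like `incStar_nonneg_of_edgeChord`, p215754, and `incStar_nonneg_of_rootKeyChord`, p228557); the identities
of this file are unaffected. -/

namespace EdgeInduction

open MeasureTheory Literature.Probability.Percolation Literature.Probability.LatticeModels
open scoped Classical

variable {n : ℕ}

/-- **Pivotal form of the first mixed coefficient**: `3B₁ = 3E₃(μ) + 2δ_{ABC} + Σ_cyc δ_A μ(B)μ(C) − Σ_cyc (δ_A μ(B∩C) + μ(A) δ_{B∩C})`
(`= 3B₀ + f'(0)`), `δ_X = ν(X) − μ(X)`. [this work] -/
theorem three_mul_polar₁_eq_pivotal (μ ν : Measure (BondConfig (Fin n))) (A B C : Set (BondConfig (Fin n))) :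
    3 * polar₁ μ ν A B C =
      3 * sahiE3 μ A B C + 2 * (ν.real (A ∩ B ∩ C) - μ.real (A ∩ B ∩ C))
        + ((ν.real A - μ.real A) * μ.real B * μ.real C + (ν.real B - μ.real B) * μ.real A * μ.real C
            + (ν.real C - μ.real C) * μ.real A * μ.real B)
        - ((ν.real A - μ.real A) * μ.real (B ∩ C) + μ.real A * (ν.real (B ∩ C) - μ.real (B ∩ C))
            + (ν.real B - μ.real B) * μ.real (A ∩ C) + μ.real B * (ν.real (A ∩ C) - μ.real (A ∩ C))
            + (ν.real C - μ.real C) * μ.real (A ∩ B) + μ.real C * (ν.real (A ∩ B) - μ.real (A ∩ B))) := by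
  simp only [sahiE3, polar₁]
  ring

/-- **Pivotal form of the second mixed coefficient**: `3B₂ = 3E₃(ν) − 2δ_{ABC} − Σ_cyc δ_A ν(B)ν(C) + Σ_cyc (δ_A ν(B∩C) + ν(A) δ_{B∩C})`
(`= 3B₃ − f'(1)`). [this work] -/
theorem three_mul_polar₁_eq_pivotal' (μ ν : Measure (BondConfig (Fin n))) (A B C : Set (BondConfig (Fin n))) :
    3 * polar₁ ν μ A B C =
      3 * sahiE3 ν A B C - 2 * (ν.real (A ∩ B ∩ C) - μ.real (A ∩ B ∩ C))
        - ((ν.real A - μ.real A) * ν.real B * ν.real C + (ν.real B - μ.real B) * ν.real A * ν.real C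
            + (ν.real C - μ.real C) * ν.real A * ν.real B)
        + ((ν.real A - μ.real A) * ν.real (B ∩ C) + ν.real A * (ν.real (B ∩ C) - μ.real (B ∩ C))
            + (ν.real B - μ.real B) * ν.real (A ∩ C) + ν.real B * (ν.real (A ∩ C) - μ.real (A ∩ C))
            + (ν.real C - μ.real C) * ν.real (A ∩ B) + ν.real C * (ν.real (A ∩ B) - μ.real (A ∩ B))) := by
  simp only [sahiE3, polar₁]
  ring

/-- **The four one-pair curvature slacks are linear in the two second differences**: with `Δ₀ = B₀ − 2B₁ + B₂`, `Δ₁ = B₁ − 2B₂ + B₃`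
one has `3B₁ − 2B₀ − B₃ = −2Δ₀ − Δ₁` and `3B₂ − B₀ − 2B₃ = −Δ₀ − 2Δ₁`; in particular Bernstein positivity `B₁, B₂ ≥ 0` (the surviving
hypothesis) needs neither `Δ₀ ≤ 0` nor `Δ₁ ≤ 0`. [folklore] -/
theorem chordSlacks_eq_second_diffs (B₀ B₁ B₂ B₃ : ℝ) :
    3 * B₁ - 2 * B₀ - B₃ = -2 * (B₀ - 2 * B₁ + B₂) - (B₁ - 2 * B₂ + B₃) ∧
      3 * B₂ - B₀ - 2 * B₃ = -(B₀ - 2 * B₁ + B₂) - 2 * (B₁ - 2 * B₂ + B₃) := by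
  constructor <;> ring

end EdgeInduction

end Summit.CriticalPhenomena.PercolationContinuityZ3.Theorems
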